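import Literature.Computability.Cryptography.PeikertMachineAnalysis
import Literature.Computability.Complexity.CountingHierarchyProofs
import Mathlib.Analysis.Complex.ExponentialBounds
import HarnessLib

/-!
# The first component `h₁` of Peikert's `GapSVP → LWE` reduction: the machine and its analysis assembled

Topic `Computability/Cryptography` (family `pqc`), final analysis file of `PeikertMachineSpec.lean`.
**`h1_gapSVP_to_bdd`** is hypothesis `h₁` of `peikert_gapSVPZeta_to_lwe_classical_of_components`
(`PeikertReduction.lean`, named fact `Literature.Computability.Cryptography.peikert_gapSVPZeta_to_lwe_classical`,
pqc.S20) in the `√(log n)`-free regime `γ ≥ γ₀ = 2n/α` (Peikert's factor `√(log n)` only sharpens the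
approximation factor to `O(n/(α√(log n)))`; pqc.S20 asks `Õ(n/α)`): from ANY randomised solver `R` of
the `f`-admissible `BDD` inputs (`SolvesBDD`), ONE polynomial-time oracle machine (`ttAlgL` of
`Complexity/TruthTableDecidersL.lean` run with `R` as a randomised subroutine, on the queries and verdict
of `PeikertMachineSpec.lean`, `exists_query_mem_FP` / `exists_verdict_mem_P`) decides `GapSVP_{ζ,γ}` with
error `≤ 1/3`: YES instances by `prob_block_ok_le_of_yes` and independence of the `N₀ = ⌈4/hidingAdvantage⌉`
iterations (`prob_coins_forall_mem`, `(1 - hA/2)^{N₀} ≤ e^{-2} < 1/3`), NO instances by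
`prob_block_notok_le_of_no` and the union bound (`prob_coins_exists_mem_le`), eventually in `n`.

Also the assembly at `γ = max 1 (2n/α)`: `peikertGamma'`, `eventually_two_le_modulus'`,
**`peikert_gapSVPZeta_to_lwe_classical_of_components'`** — pqc.S20 from `h1_gapSVP_to_bdd`'s shape and
the second component `h₂` (the LWE-oracle BDD solver, Regev's Lemma 3.4 side).

All PROVED; no named fact.

## References

* C. Peikert, *Public-key cryptosystems from the worst-case shortest vector problem*, STOC 2009, Thm. 3.1
  and its proof (full version Dagstuhl 08491 pp. 11–12) [Peikert2009].
* S. Arora, B. Barak, *Computational Complexity: A Modern Approach*, CUP 2009, §7.4.1 (error reduction by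
  independent repetitions) [AroraBarak2009].
-/

noncomputable section

namespace Literature.Computability.Cryptography

namespace Peikert2009

namespace Spec

open _root_.Computability Literature.Algebra.EuclideanLattices Literature.Algebra.EuclideanLattices.GapCodes
  Literature.Probability.Distributions Literature.Computability.Complexity Polynomial PMF Filter Asymptotics
  Literature.Computability.Complexity.CodeFP Literature.Computability.Cryptography.SIS.OddPartFP TTClosure
open scoped ENNReal

/-! ### Numerical constants -/

/-- `e^{41} < 2^{65}` (`e < 3`, `3^{41} < 2^{65}`). [folklore] -/
theorem exp_41_lt : Real.exp 41 < (2 : ℝ) ^ 65 := by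
  have h1 : Real.exp 41 = Real.exp 1 ^ 41 := by rw [← Real.exp_nat_mul]; norm_num
  have h2 : Real.exp 1 < 3 := lt_trans Real.exp_one_lt_d9 (by norm_num)
  have h3 : Real.exp 1 ^ 41 < 3 ^ 41 := pow_lt_pow_left₀ h2 (Real.exp_pos 1).le (by norm_num)
  rw [h1]
  exact h3.trans (by norm_num)

/-- **The hiding advantage is at least `2^{-68}`** (`hidingAdvantage = e^{-81/2}/(2√(2π))`, `√(2π) < 3`).
[folklore] -/
theorem hidingAdvantage_ge : ((2 : ℝ) ^ 68)⁻¹ ≤ hidingAdvantage := by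
  unfold hidingAdvantage
  have hpi : Real.sqrt (2 * Real.pi) < 3 := by
    rw [Real.sqrt_lt' (by norm_num)]
    have := Real.pi_lt_d2; nlinarith
  have hpi0 : 0 < Real.sqrt (2 * Real.pi) := Real.sqrt_pos.2 (by positivity)
  have hexp : ((2 : ℝ) ^ 65)⁻¹ ≤ Real.exp (-(81 / 2)) := by
    rw [Real.exp_neg, inv_le_inv₀ (by positivity) (Real.exp_pos _)]
    exact ((Real.exp_le_exp.2 (by norm_num : (81 / 2 : ℝ) ≤ 41)).trans exp_41_lt.le)
  calc ((2 : ℝ) ^ 68)⁻¹ = (3 : ℝ)⁻¹ * ((3 / 8) * ((2 : ℝ) ^ 65)⁻¹) := by norm_num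
    _ ≤ (Real.sqrt (2 * Real.pi))⁻¹ * Real.exp (-(81 / 2)) / 2 := by
        rw [mul_div_assoc]
        refine mul_le_mul (by rw [inv_le_inv₀ (by norm_num) hpi0]; exact hpi.le) ?_ (by positivity) (by positivity)
        rw [le_div_iff₀ (by norm_num)]
        nlinarith [hexp]

/-- **The sampler's statistical error is negligible against the hiding advantage**:
`n · 8 · 2^{-(80 + size n)} ≤ hidingAdvantage / 2` (`n < 2^{size n}`). [folklore] -/
theorem tvErr_le_half_hidingAdvantage (n : ℕ) : n * (8 * ((2 : ℝ) ^ prec n)⁻¹) ≤ hidingAdvantage / 2 := by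
  have h1 : (n : ℝ) < 2 ^ Nat.size n := by exact_mod_cast Nat.lt_size_self n
  have h2 : (n : ℝ) * (8 * ((2 : ℝ) ^ prec n)⁻¹) ≤ 8 * ((2 : ℝ) ^ 80)⁻¹ := by
    unfold prec
    rw [pow_add, mul_inv]
    have hpos : (0 : ℝ) < 2 ^ Nat.size n := by positivity
    calc (n : ℝ) * (8 * (((2 : ℝ) ^ 80)⁻¹ * ((2 : ℝ) ^ Nat.size n)⁻¹)) = 8 * ((2 : ℝ) ^ 80)⁻¹ * (n * ((2 : ℝ) ^ Nat.size n)⁻¹) := by ring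
      _ ≤ 8 * ((2 : ℝ) ^ 80)⁻¹ * 1 := by
          refine mul_le_mul_of_nonneg_left ?_ (by positivity)
          rw [mul_inv_le_iff₀ hpos, one_mul]; exact h1.le
      _ = _ := mul_one _
  have h3 : 8 * ((2 : ℝ) ^ 80)⁻¹ ≤ ((2 : ℝ) ^ 68)⁻¹ / 2 := by norm_num
  linarith [hidingAdvantage_ge]

/-- `N₀ = ⌈4/hidingAdvantage⌉ ≤ 2^71`. [folklore] -/
theorem iters_le : (iters : ℝ) ≤ (2 : ℝ) ^ 71 := by
  unfold iters
  have hA := hidingAdvantage_ge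
  have hApos := hidingAdvantage_pos
  have h4 : 4 / hidingAdvantage ≤ 4 * (2 : ℝ) ^ 68 := by
    rw [div_le_iff₀ hApos]
    calc (4 : ℝ) = 4 * (2 : ℝ) ^ 68 * ((2 : ℝ) ^ 68)⁻¹ := by norm_num
      _ ≤ 4 * (2 : ℝ) ^ 68 * hidingAdvantage := mul_le_mul_of_nonneg_left hA (by positivity)
  calc (⌈4 / hidingAdvantage⌉₊ : ℝ) ≤ 4 / hidingAdvantage + 1 := (Nat.ceil_lt_add_one (by positivity)).le
    _ ≤ 4 * (2 : ℝ) ^ 68 + 1 := by linarith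
    _ ≤ (2 : ℝ) ^ 71 := by norm_num

/-- `4/hidingAdvantage ≤ N₀`. [folklore] -/
theorem four_div_le_iters : 4 / hidingAdvantage ≤ (iters : ℝ) := Nat.le_ceil _

/-- **`(1 - hA/2)^{N₀} ≤ 1/3`** (`≤ e^{-hA N₀/2} ≤ e^{-2}` and `3 ≤ e²`). [cite: AroraBarak2009, §7.4.1] -/
theorem pow_iters_le_third : (1 - hidingAdvantage / 2) ^ iters ≤ 1 / 3 := by
  have hApos := hidingAdvantage_pos
  have hbase : 0 ≤ 1 - hidingAdvantage / 2 := by linarith [hidingAdvantage_le_half]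
  calc (1 - hidingAdvantage / 2) ^ iters ≤ Real.exp (-(hidingAdvantage / 2)) ^ iters :=
        pow_le_pow_left₀ hbase (Real.one_sub_le_exp_neg _) _
    _ = Real.exp (-(hidingAdvantage / 2 * iters)) := by rw [← Real.exp_nat_mul]; congr 1; ring
    _ ≤ Real.exp (-2) := by
        rw [Real.exp_le_exp, neg_le_neg_iff]
        have := four_div_le_iters
        rw [div_le_iff₀ hApos] at this
        nlinarith
    _ ≤ 1 / 3 := by
        rw [Real.exp_neg, inv_le_comm₀ (Real.exp_pos 2) (by norm_num)]
        have := Real.add_one_le_exp 2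
        norm_num at this ⊢
        linarith

/-! ### The tail terms of the NO case vanish -/

/-- `2^{n/2} e^{-2n} ≤ 1/(n + 1)`. [folklore] -/
theorem gaussTail_le (n : ℕ) : (2 : ℝ) ^ ((n : ℝ) / 2) * Real.exp (-(2 * n)) ≤ 1 / ((n : ℝ) + 1) := by
  have h1 : (2 : ℝ) ^ ((n : ℝ) / 2) ≤ Real.exp n := by
    rw [Real.rpow_def_of_pos (by norm_num), Real.exp_le_exp]
    have := Real.log_two_lt_d9
    have hn : (0 : ℝ) ≤ n := Nat.cast_nonneg n
    nlinarith
  have h2 : (2 : ℝ) ^ ((n : ℝ) / 2) * Real.exp (-(2 * n)) ≤ Real.exp (-n) := by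
    calc (2 : ℝ) ^ ((n : ℝ) / 2) * Real.exp (-(2 * n)) ≤ Real.exp n * Real.exp (-(2 * n)) :=
          mul_le_mul_of_nonneg_right h1 (Real.exp_pos _).le
      _ = Real.exp (-n) := by rw [← Real.exp_add]; congr 1; ring
  refine h2.trans ?_
  rw [Real.exp_neg, one_div, inv_le_inv₀ (Real.exp_pos _) (by positivity)]
  exact Real.add_one_le_exp n

/-- **Eventually the NO-case error is below `1/3`**:
`N₀ · (2^{n/2}e^{-2n} + n·8·2^{-m} + 1/n) ≤ 1/3` for all large `n`. [cite: Peikert2009, Thm. 3.1 proof (NO case)] -/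
theorem eventually_noErr_le :
    ∀ᶠ n : ℕ in atTop, (iters : ℝ) * ((2 : ℝ) ^ ((n : ℝ) / 2) * Real.exp (-(2 * n)) + n * (8 * ((2 : ℝ) ^ prec n)⁻¹) + 1 / (n : ℝ) ^ (1 : ℕ)) ≤ 1 / 3 := by
  filter_upwards [eventually_ge_atTop (2 ^ 75)] with n hn
  have hnR : (2 : ℝ) ^ 75 ≤ n := by exact_mod_cast hn
  have hnpos : (0 : ℝ) < n := lt_of_lt_of_le (by positivity) hnR
  have hI := iters_le
  have hI0 : (0 : ℝ) ≤ iters := Nat.cast_nonneg _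
  have ht1 : (2 : ℝ) ^ ((n : ℝ) / 2) * Real.exp (-(2 * n)) ≤ 1 / (n : ℝ) := (gaussTail_le n).trans (by
    rw [one_div_le_one_div (by positivity) hnpos]; linarith)
  have ht2 : (n : ℝ) * (8 * ((2 : ℝ) ^ prec n)⁻¹) ≤ hidingAdvantage / 2 := tvErr_le_half_hidingAdvantage n
  have ht2' : (n : ℝ) * (8 * ((2 : ℝ) ^ prec n)⁻¹) ≤ 8 * ((2 : ℝ) ^ 80)⁻¹ := by
    have h1 : (n : ℝ) < 2 ^ Nat.size n := by exact_mod_cast Nat.lt_size_self n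
    unfold prec; rw [pow_add, mul_inv]
    have hpos : (0 : ℝ) < 2 ^ Nat.size n := by positivity
    calc (n : ℝ) * (8 * (((2 : ℝ) ^ 80)⁻¹ * ((2 : ℝ) ^ Nat.size n)⁻¹)) = 8 * ((2 : ℝ) ^ 80)⁻¹ * (n * ((2 : ℝ) ^ Nat.size n)⁻¹) := by ring
      _ ≤ 8 * ((2 : ℝ) ^ 80)⁻¹ * 1 := by
          refine mul_le_mul_of_nonneg_left ?_ (by positivity)
          rw [mul_inv_le_iff₀ hpos, one_mul]; exact h1.le
      _ = _ := mul_one _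
  rw [pow_one]
  have hsum : (2 : ℝ) ^ ((n : ℝ) / 2) * Real.exp (-(2 * n)) + n * (8 * ((2 : ℝ) ^ prec n)⁻¹) + 1 / (n : ℝ) ≤ 2 / n + 8 * ((2 : ℝ) ^ 80)⁻¹ := by
    have : 1 / (n : ℝ) + 1 / n = 2 / n := by ring
    linarith
  calc (iters : ℝ) * _ ≤ (2 : ℝ) ^ 71 * (2 / n + 8 * ((2 : ℝ) ^ 80)⁻¹) := mul_le_mul hI hsum (by positivity) (by positivity)
    _ ≤ (2 : ℝ) ^ 71 * (2 / (2 : ℝ) ^ 75 + 8 * ((2 : ℝ) ^ 80)⁻¹) := by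
        refine mul_le_mul_of_nonneg_left (add_le_add ?_ le_rfl) (by positivity)
        exact div_le_div_of_nonneg_left (by norm_num) (by positivity) hnR
    _ ≤ 1 / 3 := by norm_num

/-! ### The run of the machine on a coin string -/

variable {q : ℕ → ℕ} {a : ℕ → ℚ}

/-- The truth-table decider's queries on `⟨code p, r⟩` are the machine's queries. [folklore] -/
theorem ttQueries_eq (coinsR : Polynomial ℕ) {Q : List Bool → List Bool}
    (hQe : ∀ (p : GapSVPInstance) (r : List Bool) (j : ℕ), Q (boolPair (boolPair p.encode r) (List.replicate j true)) = query (mkInp q a p) coinsR r j)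
    (p : GapSVPInstance) (r : List Bool) :
    ttQueries Q (boolPair p.encode r) iters = (List.range iters).map fun j => query (mkInp q a p) coinsR r j := by
  unfold ttQueries
  exact List.map_congr_left fun j _ => hQe p r j

/-- `2/3` as an extended nonnegative real. [folklore] -/
theorem two_thirds_ennreal : (2 / 3 : ℝ≥0∞) = ENNReal.ofReal (2 / 3) := by
  rw [ENNReal.ofReal_div_of_pos (by norm_num)]; simp

/-! ### The theorem -/

/-- **The first component of Peikert's reduction (`h₁`, regime `γ ≥ 2n/α`).** For LWE parameters
`(q, α, m)` polynomial-time computable from `1ⁿ` with `α(n) ∈ (0,1)` eventually, any `γ`, `ζ`, `f → ∞`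
with, eventually, `2n/α(n) ≤ γ(n) ≤ ζ(n)` and `ζ(n) f(n) √(log n)/√n ≤ q(n)`, and any polynomial-time
randomised oracle algorithm `R` (coins `coinsR`, rounds `fuelR`): there is ONE polynomial-time oracle
machine `M` (with its coin and round polynomials) such that for every oracle `O` for which `R` solves the
`f`-admissible `BDD` inputs (`SolvesBDD`), `M` with oracle `O` decides `GapSVP_{ζ,γ}` with error `≤ 1/3`
on all instances of every large enough dimension. `M` is `ttAlgL` on the queries/verdict of
`PeikertMachineSpec.lean` with `R` as randomised subroutine. [cite: Peikert2009, Thm. 3.1 (proof)] -/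
theorem h1_gapSVP_to_bdd {α : ℕ → ℝ} {m : ℕ → ℕ}
    (hpar : IsPolyTimeParams q α m) (hαev : ∀ᶠ n : ℕ in atTop, 0 < α n ∧ α n < 1) (γ ζ f : ℕ → ℝ)
    (hf : Tendsto f atTop atTop)
    (hbounds : ∀ᶠ n : ℕ in atTop, 2 * n / α n ≤ γ n ∧ γ n ≤ ζ n ∧ ζ n * f n * Real.sqrt (Real.log n) / Real.sqrt n ≤ q n)
    (R : OracleAlg (List Bool)) (coinsR fuelR : Polynomial ℕ) (hR : R.IsPolyTime (encodingList Bool)) :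
    ∃ (M : OracleAlg Bool) (coins fuel : Polynomial ℕ), M.IsPolyTime encodingBoolBool ∧
      ∀ O : Oracle, SolvesBDD q α f R coinsR fuelR O →
        ∀ᶠ n in atTop, ∀ p : GapSVPInstance, p.1.n = n →
          (p ∈ GapSVPZeta.yes ζ γ → 2 / 3 ≤ M.randRun O coins fuel p.encode (some true)) ∧
          (p ∈ GapSVPZeta.no ζ γ → 2 / 3 ≤ M.randRun O coins fuel p.encode (some false)) := by
  classical
  obtain ⟨hqpt, -, a, hαa, hapt⟩ := hpar
  obtain ⟨Q, hQ, hQe⟩ := exists_query_mem_FP coinsR hqpt hapt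
  obtain ⟨D, hD, hDe⟩ := exists_verdict_mem_P coinsR hqpt hapt
  obtain ⟨C, hC, qC, hCrun⟩ := exists_polyTime_ttRandDecider hQ hD (Polynomial.C iters) hR fuelR []
  -- coins: enough for `N₀` blocks (`blockLen` is polynomially bounded: it is computed in unary in `FP`)
  obtain ⟨F, hF, hFe⟩ := ((blockLenUn_codeFP coinsR).comp (mkInp_codeFP hqpt hapt) : CodeFP GapSVPInstance.encode unE _)
  obtain ⟨Pol, hPol⟩ := exists_poly_length_le_of_mem_FP hF
  have hblock : ∀ p : GapSVPInstance, blockLen (mkInp q a p) coinsR ≤ Pol.eval p.encode.length := fun p => by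
    have h := hPol p.encode
    rw [hFe p] at h
    simpa only [length_unE] using h
  set coins : Polynomial ℕ := Polynomial.C iters * Pol with hcoins
  set fuel : Polynomial ℕ := qC.comp (2 * X + 2 + coins) with hfuel
  refine ⟨C, coins, fuel, hC, fun O hO => ?_⟩
  filter_upwards [hαev, hbounds, hf.eventually_ge_atTop 1, eventually_ge_atTop 3, hO 1, eventually_noErr_le] with
    n hαn hbn hfn hn3 hSn hnoErr p hpn
  subst hpn
  set ι : Inp := mkInp q a p with hι
  -- the run on coins `r`
  have hlen : ∀ r : List.Vector Bool (coins.eval p.encode.length),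
      (boolPair p.encode r.toList).length = (2 * X + 2 + coins).eval p.encode.length := fun r => by
    rw [length_boolPair, List.Vector.toList_length]; simp
  have hrun : ∀ r : List.Vector Bool (coins.eval p.encode.length),
      C.run O (fuel.eval p.encode.length) (boolPair p.encode r.toList) =
        some (decide ((dden ι : ℤ) ≤ dnum ι) && (List.range iters).any fun j =>
          !okBlk coinsR fuelR R O ι (block ι coinsR r.toList j)) := fun r => by
    have h := hCrun O (boolPair p.encode r.toList)
    rw [hlen r] at h
    rw [hfuel, eval_comp, h, ttDecL, eval_C, ttQueries_eq coinsR hQe, List.map_map]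
    congr 1
    rw [show ((fun j => query (mkInp q a p) coinsR r.toList j) : ℕ → List Bool) = fun j => query ι coinsR r.toList j from rfl]
    have hmap : (List.range iters).map (OracleAlg.randAnswer R fuelR [] O ∘ fun j => query ι coinsR r.toList j) =
        (List.range iters).map fun j => OracleAlg.randAnswer R fuelR [] O (query ι coinsR r.toList j) := rfl
    rw [hmap, hDe p r.toList, ← hι, verdict_run]
  have hprob : ∀ b : Bool, C.randRun O coins fuel p.encode (some b) =
      (uniformOfFintype (List.Vector Bool (coins.eval p.encode.length))).toOuterMeasure
        {r | (decide ((dden ι : ℤ) ≤ dnum ι) && (List.range iters).any fun j =>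
          !okBlk coinsR fuelR R O ι (block ι coinsR r.toList j)) = b} := fun b => by
    rw [OracleAlg.randRun, ← toOuterMeasure_apply_singleton, toOuterMeasure_map_apply]
    congr 1
    ext r
    simp only [Set.mem_preimage, Set.mem_singleton_iff, hrun r, Option.some.injEq, Set.mem_setOf_eq]
  have hcoinsN : blockLen ι coinsR * iters ≤ coins.eval p.encode.length := by
    rw [hcoins, eval_mul, eval_C, mul_comm]
    exact Nat.mul_le_mul_left _ (hblock p)
  -- shared facts about the parameters at this dimension
  have hn1 : 1 ≤ dim ι := le_trans (by norm_num) hn3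
  have hα0 : 0 < α (dim ι) := hαn.1
  have ha0 : 0 < a (dim ι) := by have := hαa (dim ι); rw [this] at hα0; exact_mod_cast hα0
  have hanum : 0 < anum ι := Rat.num_pos.2 ha0
  have haden : 0 < aden ι := (a (dim ι)).den_pos
  have hαa' : α (dim ι) = (anum ι : ℝ) / aden ι := by rw [hαa]; exact Rat.cast_def _
  have hqv : (qv ι : ℝ) = q (dim ι) := rfl
  -- the two "every iteration is fine" events coincide
  set Sok : Set (List Bool) := {blk | okBlk coinsR fuelR R O ι blk = true} with hSok
  have hall : ∀ r : List.Vector Bool (coins.eval p.encode.length),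
      ((List.range iters).any fun j => !okBlk coinsR fuelR R O ι (block ι coinsR r.toList j)) = false ↔
        ∀ j < iters, block ι coinsR r.toList j ∈ Sok := fun r => by
    rw [List.any_eq_false]
    simp only [List.mem_range, Bool.not_eq_true', Bool.not_eq_false, hSok, Set.mem_setOf_eq]
  constructor
  · -- YES: accept unless every iteration is fooled; each is fooled w.p. `≤ 1 - hA/2`, independently
    intro hyes
    have hd1 : (1 : ℝ) ≤ ι.1.2 := hyes.1.2.2.2.1
    have hd : decide ((dden ι : ℤ) ≤ dnum ι) = true := by
      rw [decide_eq_true_eq]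
      have h := hd1
      rw [d_eq_num_div_den ι, le_div_iff₀ (by exact_mod_cast ι.1.2.den_pos), one_mul] at h
      exact_mod_cast h
    rw [hprob true]
    set U := uniformOfFintype (List.Vector Bool (coins.eval p.encode.length)) with hU
    have hset : {r : List.Vector Bool (coins.eval p.encode.length) |
        (decide ((dden ι : ℤ) ≤ dnum ι) && (List.range iters).any fun j => !okBlk coinsR fuelR R O ι (block ι coinsR r.toList j)) = true} =
        {r | ∀ j < iters, block ι coinsR r.toList j ∈ Sok}ᶜ := by
      ext r
      simp only [hd, Bool.true_and, Set.mem_setOf_eq, Set.mem_compl_iff]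
      rw [← hall r, Bool.not_eq_false]
    rw [hset]
    have hforall := prob_coins_forall_mem coinsR ι hcoinsN Sok
    have hθ : ((uniformOfFintype (List.Vector Bool (blockLen ι coinsR))).toOuterMeasure {b | b.toList ∈ Sok}).toReal ≤ 1 - hidingAdvantage / 2 := by
      have h := prob_block_ok_le_of_yes coinsR fuelR R O ι hyes hn1
      have := tvErr_le_half_hidingAdvantage (dim ι)
      simpa [hSok] using (by linarith : ((uniformOfFintype (List.Vector Bool (blockLen ι coinsR))).toOuterMeasure
        {blk | okBlk coinsR fuelR R O ι blk.toList = true}).toReal ≤ 1 - hidingAdvantage / 2)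
    have hpow : (U.toOuterMeasure {r | ∀ j < iters, block ι coinsR r.toList j ∈ Sok}).toReal ≤ 1 / 3 := by
      rw [hU, hforall, ENNReal.toReal_pow]
      exact (pow_le_pow_left₀ ENNReal.toReal_nonneg hθ _).trans pow_iters_le_third
    have hcompl := toReal_toOuterMeasure_compl U {r | ∀ j < iters, block ι coinsR r.toList j ∈ Sok}
    have hne : U.toOuterMeasure {r | ∀ j < iters, block ι coinsR r.toList j ∈ Sok}ᶜ ≠ ∞ :=
      ne_top_of_le_ne_top ENNReal.one_ne_top (le_of_le_of_eq le_add_self (toOuterMeasure_compl_add U _))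
    rw [two_thirds_ennreal, ENNReal.ofReal_le_iff_le_toReal hne, hcompl]
    linarith
  · -- NO: reject unless some iteration misfires; union bound over the `N₀` iterations
    intro hno
    have hd1 : (1 : ℝ) ≤ ι.1.2 := hno.1.2.2.2.1
    have hd : decide ((dden ι : ℤ) ≤ dnum ι) = true := by
      rw [decide_eq_true_eq]
      have h := hd1
      rw [d_eq_num_div_den ι, le_div_iff₀ (by exact_mod_cast ι.1.2.den_pos), one_mul] at h
      exact_mod_cast h
    rw [hprob false]
    set U := uniformOfFintype (List.Vector Bool (coins.eval p.encode.length)) with hU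
    set Sbad : Set (List Bool) := {blk | okBlk coinsR fuelR R O ι blk = false} with hSbad
    have hset : {r : List.Vector Bool (coins.eval p.encode.length) |
        (decide ((dden ι : ℤ) ≤ dnum ι) && (List.range iters).any fun j => !okBlk coinsR fuelR R O ι (block ι coinsR r.toList j)) = false} =
        {r | ∃ j < iters, block ι coinsR r.toList j ∈ Sbad}ᶜ := by
      ext r
      simp only [hd, Bool.true_and, Set.mem_setOf_eq, Set.mem_compl_iff, hall r, hSok, hSbad, not_exists, not_and,
        Bool.not_eq_false]
    rw [hset]
    -- the modulus is at least `1` and `f ≥ 0` at this dimension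
    have hf0 : 0 ≤ f (dim ι) := le_trans zero_le_one hfn
    have hq1 : 1 ≤ q (dim ι) := by
      obtain ⟨hγ, hγζ, hq⟩ : 2 * (dim ι : ℝ) / α (dim ι) ≤ γ (dim ι) ∧ γ (dim ι) ≤ ζ (dim ι) ∧
          ζ (dim ι) * f (dim ι) * Real.sqrt (Real.log (dim ι)) / Real.sqrt (dim ι) ≤ q (dim ι) := hbn
      have hL := one_le_sqrt_log hn3
      have hnR : (3 : ℝ) ≤ dim ι := by exact_mod_cast hn3
      have hs : 0 < Real.sqrt (dim ι) := Real.sqrt_pos.2 (by linarith)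
      have hs' : Real.sqrt (dim ι) ≤ dim ι := by
        rw [Real.sqrt_le_left (by linarith)]; nlinarith
      have hα1 : α (dim ι) < 1 := hαn.2
      have hγpos : (2 : ℝ) * dim ι ≤ γ (dim ι) := by
        refine le_trans ?_ hγ
        rw [le_div_iff₀ hα0]
        have := mul_le_mul_of_nonneg_left hα1.le (show (0 : ℝ) ≤ 2 * (dim ι : ℝ) by positivity)
        linarith
      have hchain : (2 : ℝ) * dim ι * 1 * 1 / Real.sqrt (dim ι) ≤ q (dim ι) := by
        refine le_trans ?_ hq
        rw [div_le_div_iff_of_pos_right hs]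
        have hζ : 2 * (dim ι : ℝ) ≤ ζ (dim ι) := hγpos.trans hγζ
        exact mul_le_mul (mul_le_mul hζ hfn zero_le_one (by linarith)) hL zero_le_one (by nlinarith)
      have : (1 : ℝ) ≤ q (dim ι) := by
        refine le_trans ?_ hchain
        rw [le_div_iff₀ hs]; nlinarith
      exact_mod_cast this
    have hexists := prob_coins_exists_mem_le coinsR ι hcoinsN Sbad
    have hbad : ((uniformOfFintype (List.Vector Bool (blockLen ι coinsR))).toOuterMeasure {b | b.toList ∈ Sbad}).toReal ≤
        (2 : ℝ) ^ ((dim ι : ℝ) / 2) * Real.exp (-(2 * dim ι)) + dim ι * (8 * ((2 : ℝ) ^ prec (dim ι))⁻¹) + 1 / (dim ι : ℝ) ^ (1 : ℕ) := by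
      have h := prob_block_notok_le_of_no coinsR fuelR R O ι hno hn3 hα0 hαn.2 hf0 hq1 hqv hanum haden hαa' hbn.1 hbn.2.2
        (ε := 1 / (dim ι : ℝ) ^ (1 : ℕ)) (by positivity) (by
          rw [pow_one, div_le_one (by exact_mod_cast (lt_of_lt_of_le zero_lt_one hn1))]; exact_mod_cast hn1)
        (fun p' hp' hadm => hSn p' hp' hadm)
      simpa [hSbad] using h
    have hne1 : (uniformOfFintype (List.Vector Bool (blockLen ι coinsR))).toOuterMeasure {b | b.toList ∈ Sbad} ≠ ∞ :=
      ne_top_of_le_ne_top ENNReal.one_ne_top (le_of_le_of_eq le_self_add (toOuterMeasure_compl_add _ _))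
    have hunion : (U.toOuterMeasure {r | ∃ j < iters, block ι coinsR r.toList j ∈ Sbad}).toReal ≤ 1 / 3 := by
      have h := ENNReal.toReal_mono (ENNReal.mul_ne_top (ENNReal.natCast_ne_top iters) hne1) hexists
      rw [ENNReal.toReal_mul, ENNReal.toReal_natCast] at h
      exact h.trans ((mul_le_mul_of_nonneg_left hbad (Nat.cast_nonneg _)).trans hnoErr)
    have hcompl := toReal_toOuterMeasure_compl U {r | ∃ j < iters, block ι coinsR r.toList j ∈ Sbad}
    have hne : U.toOuterMeasure {r | ∃ j < iters, block ι coinsR r.toList j ∈ Sbad}ᶜ ≠ ∞ :=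
      ne_top_of_le_ne_top ENNReal.one_ne_top (le_of_le_of_eq le_add_self (toOuterMeasure_compl_add U _))
    rw [two_thirds_ennreal, ENNReal.ofReal_le_iff_le_toReal hne, hcompl]
    linarith

end Spec

end Peikert2009

/-! ### The assembly at `γ = max 1 (2n/α)` -/

section Assembly

open Filter Topology Asymptotics _root_.Computability Literature.Algebra.EuclideanLattices Literature.Computability.Complexity
  Literature.Computability.Cryptography.LWE

variable (q : ℕ → ℕ) [∀ n, NeZero (q n)] (α : ℕ → ℝ) (m : ℕ → ℕ)

/-- Peikert's approximation factor in the `√(log n)`-free regime: `γ(n) = max(1, 2n/α(n))` (still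
`Õ(n/α)`; the machine of `h1_gapSVP_to_bdd` decides `GapSVP_{ζ,γ}` for every `γ ≥ 2n/α`). [cite: Peikert2009, Thm. 3.1] -/
def peikertGamma' (n : ℕ) : ℝ := max 1 (2 * n / α n)

/-- `1 ≤ γ'(n)`. [folklore] -/
theorem one_le_peikertGamma' (n : ℕ) : 1 ≤ peikertGamma' α n := le_max_left _ _

/-- `2n/α(n) ≤ γ'(n)`. [folklore] -/
theorem le_peikertGamma' (n : ℕ) : 2 * n / α n ≤ peikertGamma' α n := le_max_right _ _

/-- `γ' = Õ(n/α)`: eventually `γ'(n) ≤ 2 (n/α(n))`. [cite: Peikert2009, Thm. 3.1] -/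
theorem isSoftBigO_peikertGamma' (hα : ∀ᶠ n : ℕ in atTop, 0 < α n ∧ α n < 1) :
    IsSoftBigO (peikertGamma' α) (fun n => n / α n) := by
  refine IsSoftBigO.of_isBigO (IsBigO.of_bound 2 ?_)
  filter_upwards [hα, eventually_ge_atTop 1] with n hαn hn
  have hα0 : 0 < α n := hαn.1
  have hn1 : (1 : ℝ) ≤ n := by exact_mod_cast hn
  have hna : 1 ≤ (n : ℝ) / α n := by
    rw [le_div_iff₀ hα0]; linarith [hαn.2]
  have hγ : peikertGamma' α n ≤ 2 * (n / α n) := max_le (by linarith) (by rw [mul_div_assoc])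
  have hγ0 : 0 ≤ peikertGamma' α n := le_trans zero_le_one (one_le_peikertGamma' α n)
  rw [Real.norm_of_nonneg hγ0, Real.norm_of_nonneg (le_trans zero_le_one hna)]
  exact hγ

omit [∀ n, NeZero (q n)] in
/-- Under S20's modulus hypothesis for `γ = peikertGamma' α`, eventually `2 ≤ q(n)`:
`q ≥ ζ f √(log n)/√n ≥ (2n/α) f √(log n)/√n ≥ 2√n f ≥ 2`. [cite: Peikert2009, Prop. 3.2 (`q(n) ≥ 2`)] -/
theorem eventually_two_le_modulus' (hα : ∀ᶠ n : ℕ in atTop, 0 < α n ∧ α n < 1) {ζ f : ℕ → ℝ}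
    (hf : Tendsto f atTop atTop)
    (hζ : ∀ᶠ n : ℕ in atTop, peikertGamma' α n ≤ ζ n ∧ ζ n * f n * Real.sqrt (Real.log n) / Real.sqrt n ≤ q n) :
    ∀ᶠ n : ℕ in atTop, 2 ≤ q n := by
  filter_upwards [hα, hζ, hf.eventually_ge_atTop 1, eventually_ge_atTop 3] with n hαn hζn hfn hn
  have hα0 : 0 < α n := hαn.1
  have hnR : (3 : ℝ) ≤ n := by exact_mod_cast hn
  have hL := Peikert2009.one_le_sqrt_log hn
  have hs : 0 < Real.sqrt (n : ℝ) := Real.sqrt_pos.2 (by linarith)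
  have hs1 : 1 ≤ Real.sqrt (n : ℝ) := by rw [Real.le_sqrt (by norm_num) (by linarith)]; linarith
  have hsn : Real.sqrt (n : ℝ) * Real.sqrt n = n := Real.mul_self_sqrt (by linarith)
  have hγn : 2 * (n : ℝ) ≤ peikertGamma' α n := by
    refine le_trans ?_ (le_peikertGamma' α n)
    rw [le_div_iff₀ hα0]
    have := mul_le_mul_of_nonneg_left hαn.2.le (show (0 : ℝ) ≤ 2 * (n : ℝ) by positivity)
    linarith
  have hζ2 : 2 * (n : ℝ) ≤ ζ n := hγn.trans hζn.1
  have hchain : 2 * (n : ℝ) * 1 * 1 / Real.sqrt n ≤ q n := by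
    refine le_trans ?_ hζn.2
    rw [div_le_div_iff_of_pos_right hs]
    exact mul_le_mul (mul_le_mul hζ2 hfn zero_le_one (by linarith)) hL zero_le_one (by nlinarith)
  have h2 : (2 : ℝ) ≤ 2 * (n : ℝ) * 1 * 1 / Real.sqrt n := by
    rw [le_div_iff₀ hs]
    nlinarith
  exact_mod_cast h2.trans hchain

/-- **pqc.S20 from its two components, `√(log n)`-free regime.** As
`peikert_gapSVPZeta_to_lwe_classical_of_components` (`PeikertReduction.lean`), with the first component
`h₁` asked only for `γ ≥ 2n/α` (the shape of `Spec.h1_gapSVP_to_bdd`) and the conclusion's `γ` taken to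
be `peikertGamma' α = max(1, 2n/α) = Õ(n/α)`. [cite: Peikert2009, Thm. 3.1 (proof: Prop. 3.2 with Regev's Lemma 3.4)] -/
theorem peikert_gapSVPZeta_to_lwe_classical_of_components'
    (h₁ : ∀ (_ : IsPolyTimeParams q α m) (_ : ∀ᶠ n : ℕ in atTop, 0 < α n ∧ α n < 1) (γ ζ f : ℕ → ℝ),
      Tendsto f atTop atTop →
      (∀ᶠ n : ℕ in atTop, 2 * n / α n ≤ γ n ∧ γ n ≤ ζ n ∧
        ζ n * f n * Real.sqrt (Real.log n) / Real.sqrt n ≤ q n) →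
      ∀ (R : OracleAlg (List Bool)) (coinsR fuelR : Polynomial ℕ), R.IsPolyTime (encodingList Bool) →
        ∃ (M : OracleAlg Bool) (coins fuel : Polynomial ℕ), M.IsPolyTime encodingBoolBool ∧
          ∀ O : Oracle, Peikert2009.SolvesBDD q α f R coinsR fuelR O →
            ∀ᶠ n in atTop, ∀ p : GapSVPInstance, p.1.n = n →
              (p ∈ GapSVPZeta.yes ζ γ → 2 / 3 ≤ M.randRun O coins fuel p.encode (some true)) ∧
              (p ∈ GapSVPZeta.no ζ γ → 2 / 3 ≤ M.randRun O coins fuel p.encode (some false)))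
    (h₂ : ∀ (_ : IsPolyTimeParams q α m) (_ : IsPolyBounded m) (_ : ∀ᶠ n : ℕ in atTop, 2 ≤ q n)
      (_ : ∀ᶠ n : ℕ in atTop, 0 < α n ∧ α n < 1) (f : ℕ → ℝ), Tendsto f atTop atTop →
      ∃ (R : OracleAlg (List Bool)) (coins fuel : Polynomial ℕ), R.IsPolyTime (encodingList Bool) ∧
        ∀ O : Oracle, O.SolvesSearchLWE q (fun n => discretizedGaussian (q n) (α n)) m (2 / 3) →
          Peikert2009.SolvesBDD q α f R coins fuel O) :
    peikert_gapSVPZeta_to_lwe_classical q α m := by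
  intro hpar hm hα
  refine ⟨peikertGamma' α, one_le_peikertGamma' α, isSoftBigO_peikertGamma' α hα, ?_⟩
  intro ζ f hf hζ
  have hq2 : ∀ᶠ n : ℕ in atTop, 2 ≤ q n := eventually_two_le_modulus' q α hα hf hζ
  obtain ⟨R, coinsR, fuelR, hRpoly, hR⟩ := h₂ hpar hm hq2 hα f hf
  have hbounds : ∀ᶠ n : ℕ in atTop, 2 * n / α n ≤ peikertGamma' α n ∧
      peikertGamma' α n ≤ ζ n ∧ ζ n * f n * Real.sqrt (Real.log n) / Real.sqrt n ≤ q n :=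
    hζ.mono fun n hn => ⟨le_peikertGamma' α n, hn.1, hn.2⟩
  obtain ⟨M, coins, fuel, hMpoly, hM⟩ := h₁ hpar hα (peikertGamma' α) ζ f hf hbounds R coinsR fuelR hRpoly
  exact ⟨M, coins, fuel, hMpoly, fun O hO => hM O (hR O hO)⟩

/-- **pqc.S20 reduced to its second component.** With `h₁` discharged by `Spec.h1_gapSVP_to_bdd`, the
named fact `peikert_gapSVPZeta_to_lwe_classical q α m` follows from the LWE-oracle `BDD` solver alone
(hypothesis `h₂`: Regev's Lemma 3.4 / Peikert's Prop. 3.2 with the classical LWE oracle).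
[cite: Peikert2009, Thm. 3.1] -/
theorem peikert_gapSVPZeta_to_lwe_classical_of_bddSolver
    (h₂ : ∀ (_ : IsPolyTimeParams q α m) (_ : IsPolyBounded m) (_ : ∀ᶠ n : ℕ in atTop, 2 ≤ q n)
      (_ : ∀ᶠ n : ℕ in atTop, 0 < α n ∧ α n < 1) (f : ℕ → ℝ), Tendsto f atTop atTop →
      ∃ (R : OracleAlg (List Bool)) (coins fuel : Polynomial ℕ), R.IsPolyTime (encodingList Bool) ∧
        ∀ O : Oracle, O.SolvesSearchLWE q (fun n => discretizedGaussian (q n) (α n)) m (2 / 3) →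
          Peikert2009.SolvesBDD q α f R coins fuel O) :
    peikert_gapSVPZeta_to_lwe_classical q α m :=
  peikert_gapSVPZeta_to_lwe_classical_of_components' q α m
    (fun hpar hα γ ζ f hf hb R coinsR fuelR hR => Peikert2009.Spec.h1_gapSVP_to_bdd hpar hα γ ζ f hf hb R coinsR fuelR hR) h₂

end Assembly

end Literature.Computability.Cryptography

end
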